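import Literature.LinearAlgebra.Matrix.HeinzKatoFurutaInequality
import Literature.LinearAlgebra.Matrix.HolderMcCarthyInequality
import Literature.LinearAlgebra.Matrix.NumericalRadiusRefinedNormBounds
import HarnessLib

/-!
# Refinements of Kittaneh's inequality via the Furuta–Kato mixed Schwarz inequality and Hölder–McCarthy
# (Alomari 2019): `w²(T) ≤ ½‖T^*T + TT^*‖ − ½ inf (⟨|T|x,x⟩ − ⟨|T^*|x,x⟩)²`,
# `w²(T) ≤ ¼‖|T| + |T^*|‖² − ¼ inf (⟨|T|x,x⟩ − ⟨|T^*|x,x⟩)²`, and the general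
# `w^{2s}(T|T|^{α+β−1})`, `w²(T|T|^{α+β−1})` bounds

Hodge foundations lane (`lit-hodgefound`, prover p24 gen 64 #7; matrix-analysis series), a sequel of
`NumericalRadiusRefinedNormBounds.lean` (#1: `|⟨Tx,x⟩| ≤ ‖T‖`, Kittaneh 2005), on top of the tree's
`HeinzKatoFurutaInequality` (Furuta's `|⟨T|T|^{α+β−1}x, y⟩|² ≤ ⟨|T|^{2α}x,x⟩⟨|T^*|^{2β}y,y⟩`, Kato's mixed Schwarz
inequality) and `HolderMcCarthyInequality` (`⟨Sx,x⟩^r ≤ ⟨S^r x,x⟩`, `r ≥ 1`).  THEOREMS ONLY: no definition, no named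
fact, net debt 0.  Complex square matrices, spectral norm (scoped `Matrix.Norms.L2Operator`).

DEF-FREE CONVENTIONS (as in the predecessors): unit vector `star x ⬝ᵥ x = 1`, `⟨Tx, x⟩ = star x ⬝ᵥ (T *ᵥ x)`;
`|T|^{2α} = (T^*T)^α = (Tᴴ * T) ^ α`, `|T^*|^{2β} = (TT^*)^β = (T * Tᴴ) ^ β` (real matrix powers, Mathlib's `CFC.rpow`),
`|T| = CFC.sqrt (Tᴴ * T)`, `|T^*| = CFC.sqrt (T * Tᴴ)`, `T|T|^{α+β−1} = T * CFC.sqrt (Tᴴ * T) ^ (α + β − 1)` (the tree's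
spelling in `furuta_norm_sq_inner_le`).  The source's bounds `w^{m}(S) ≤ M − c·inf_{‖x‖=1} Φ(x)` are vendored in the
POINTWISE form their proofs establish («for every unit vector x … Taking the supremum over all unit vector x»):
`|⟨Sx, x⟩|^m ≤ M − c·Φ(x)` for every unit `x`, which is equivalent to the printed `sup`/`inf` form.

## Source, VERBATIM

M. W. Alomari, *Improvements of some numerical radius inequalities*, arXiv:1912.01492 (2019) [Alomari2019] (held text
`paper:arxiv-1912.01492`, pp. 3–8).  (1.5) (Furuta, generalized by Dragomir): `|⟨T|T|^{α+β−1}x, y⟩|²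
≤ ⟨|T|^{2α}x, x⟩⟨|T^*|^{2β}y, y⟩` for `α, β ≥ 0`, `α + β ≥ 1`.  «**Lemma 2.1.** Let S ≥ 0 and x a unit vector. Then
`⟨Sx, x⟩^r ≤ ⟨S^r x, x⟩, r ≥ 1` (2.1) and `⟨S^r x, x⟩ ≤ ⟨Sx, x⟩^r, r ∈ [0,1]` (2.2).»  «**Lemma 2.2.** (Kittaneh–Manasrah)
`ab + min{1/p, 1/q}(a^{p/2} − b^{q/2})² ≤ a^p/p + b^q/q`.»  «**Lemma 2.3.** … In particular, if p = q = 2, then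
`(a^{1/2}b^{1/2})^m + 2^{−m}(a^{m/2} − b^{m/2})² ≤ 2^{−m/r}(a^r + b^r)^{m/r}`.»
«**Corollary 2.5.** Let T ∈ B(ℋ), α, β ≥ 0 such that α + β ≥ 1. Then `w²(T|T|^{α+β−1}) ≤ 2^{−2/r}‖|T|^{2rα} + |T^*|^{2rβ}‖^{2/r}
− ¼ inf_{‖x‖=1} (⟨|T|^{2α}x, x⟩ − ⟨|T^*|^{2β}x, x⟩)²`» (`r ≥ 1`).  «**Remark 2.6.** Setting r = 1 …
`w²(T|T|^{α+β−1}) ≤ ¼‖|T|^{2α} + |T^*|^{2β}‖² − ¼ inf (⟨|T|^{2α}x,x⟩ − ⟨|T^*|^{2β}x,x⟩)²` … Choosing α = β = ½ we get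
`w²(T) ≤ ¼‖|T| + |T^*|‖² − ¼ inf (⟨|T|x,x⟩ − ⟨|T^*|x,x⟩)²`.  However, if one choose α = β = 1, we get … `w²(T|T|)
≤ ¼‖T^*T + TT^*‖² − ¼ inf ⟨[T^*T − TT^*]x, x⟩²`.»
«**Theorem 2.12.** … In particular case, we have `w^{2s}(T|T|^{α+β−1}) ≤ ½‖|T|^{4sα} + |T^*|^{4sβ}‖
− ½ inf_{‖x‖=1} (⟨|T|^{2sα}x, x⟩ − ⟨|T^*|^{2sβ}x, x⟩)²` (2.13).  *Proof.* Let s ≥ 1 and setting y = x in (1.5), we get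
`|⟨T|T|^{α+β−1}x, x⟩|^{2s} ≤ ⟨|T|^{2α}x,x⟩^s⟨|T^*|^{2β}x,x⟩^s` (by (1.5)) `≤ ⟨|T|^{2sα}x,x⟩⟨|T^*|^{2sβ}x,x⟩` (by convexity
of t^s) `≤ (1/p)⟨|T|^{2sα}x,x⟩^p + (1/q)⟨|T^*|^{2sβ}x,x⟩^q − r₀(…)²` (by Lemma 2.2) `≤ (1/p)⟨|T|^{2spα}x,x⟩ +
(1/q)⟨|T^*|^{2sqβ}x,x⟩ − r₀(…)²` (by (2.1)).  Taking the supremum over all unit vector x, we get the required result. The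
particular case follows by setting p = q = 2.»  «**Remark 2.13.** Setting α = β = ½ … `w^{2s}(T) ≤ ½‖|T|^{2s} + |T^*|^{2s}‖
− ½ inf (⟨|T|^s x,x⟩ − ⟨|T^*|^s x,x⟩)²` for all s ≥ 1. In particular, for s = 1 … `w²(T) ≤ ½‖T^*T + TT^*‖
− ½ inf_{‖x‖=1} (⟨|T|x,x⟩ − ⟨|T^*|x,x⟩)²` (2.14), and this refines the upper bound of … Kittaneh inequality.»
«**Remark 2.14.** Setting α = β = 1 … choose s = 1 and p = q = 2 …, we get `w²(T|T|) ≤ ½‖|T|⁴ + |T^*|⁴‖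
− ½ inf (⟨|T|²x,x⟩ − ⟨|T^*|²x,x⟩)²`.»

## What is proved (all theorems; the scalar Lemmas 2.2/2.3 in the case `p = q = 2`, `m = 2` they are used in)

§ 1 scalars: `mul_add_half_sq_sub` (Lemma 2.2, `p = q = 2`: `ab + ½(a − b)² = ½(a² + b²)`), `sq_arith_mean_le_powerMean`
(Lemma 2.3, `p = q = 2`, `m = 2`: `((a + b)/2)² ≤ ((a^r + b^r)/2)^{2/r}`, `r ≥ 1`); § 2 the McCarthy steps
(`⟨S^α x,x⟩^s ≤ ⟨S^{αs}x,x⟩`); § 3 **Theorem 2.12 (2.13)** pointwise `alomari_2_13_pointwise`, `alomari_2_13`, and its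
cases **(2.14)** `alomari_2_14` (`|⟨Tx,x⟩|² ≤ ½‖T^*T + TT^*‖ − ½(⟨|T|x,x⟩ − ⟨|T^*|x,x⟩)²`), Remark 2.13
`alomari_rem_2_13`, Remark 2.14 `alomari_rem_2_14`; § 4 **Corollary 2.5** `alomari_cor_2_5_pointwise`, `alomari_cor_2_5`
and Remark 2.6 (`r = 1`; `α = β = ½`: `|⟨Tx,x⟩|² ≤ ¼‖|T| + |T^*|‖² − ¼(⟨|T|x,x⟩ − ⟨|T^*|x,x⟩)²`; `α = β = 1`);
§ 5 **Lemma 2.2** `kittanehManasrah_young` (general `p, q`, proved by weighted AM–GM) and the general **Theorem 2.12**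
`alomari_thm_2_12_pointwise`, `alomari_thm_2_12`.
-/

noncomputable section

open Matrix
open scoped ComplexOrder MatrixOrder ComplexConjugate Matrix.Norms.L2Operator

namespace Literature.LinearAlgebra.Matrix.NumericalRadiusKatoRefinements

open Literature.LinearAlgebra.Matrix.LoewnerHeinzInequality (posSemidef_rpow rpow_rpow_of_nonneg rpow_one rpow_two
  sqrt_eq_rpow)
open Literature.LinearAlgebra.Matrix.HeinzKatoFurutaInequality (furuta_norm_sq_inner_le)
open Literature.LinearAlgebra.Matrix.HolderMcCarthyInequality (holderMcCarthy_one_le)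
open Literature.LinearAlgebra.Matrix.NumericalRadiusRefinedNormBounds (norm_quadForm_le_norm)

variable {n : Type*} [Fintype n] [DecidableEq n]

/-! ## § 1. The scalar lemmas (Lemma 2.2 and Lemma 2.3 for `p = q = 2`, `m = 2`) -/

section Scalar

/-- **Lemma 2.2 for `p = q = 2`: `ab + ½(a − b)² = ½(a² + b²)`** (the refined Young inequality is an identity here).
[cite: Alomari2019, Lemma 2.2 (case `p = q = 2`)] -/
theorem mul_add_half_sq_sub (a b : ℝ) : a * b + 2⁻¹ * (a - b) ^ 2 = 2⁻¹ * (a ^ 2 + b ^ 2) := by ring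

/-- **Lemma 2.3 for `p = q = 2`, `m = 2`: `ab + ¼(a − b)² = ((a + b)/2)² ≤ ((a^r + b^r)/2)^{2/r}`** for `a, b ≥ 0`, `r ≥ 1`
(power means). [cite: Alomari2019, Lemma 2.3 (case `p = q = 2`, `m = 2`)] -/
theorem sq_arith_mean_le_powerMean {a b : ℝ} (ha : 0 ≤ a) (hb : 0 ≤ b) {r : ℝ} (hr : 1 ≤ r) :
    ((a + b) / 2) ^ 2 ≤ ((a ^ r + b ^ r) / 2) ^ (2 / r) := by
  have hr0 : 0 < r := by linarith
  have hm : 0 ≤ (a + b) / 2 := by positivity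
  have h1 : ((a + b) / 2) ^ r ≤ (a ^ r + b ^ r) / 2 := by
    have h := (convexOn_rpow hr).2 (Set.mem_Ici.mpr ha) (Set.mem_Ici.mpr hb) (by norm_num : (0 : ℝ) ≤ 2⁻¹)
      (by norm_num : (0 : ℝ) ≤ 2⁻¹) (by norm_num)
    simp only [smul_eq_mul] at h
    calc ((a + b) / 2) ^ r = (2⁻¹ * a + 2⁻¹ * b) ^ r := by ring_nf
      _ ≤ 2⁻¹ * a ^ r + 2⁻¹ * b ^ r := h
      _ = (a ^ r + b ^ r) / 2 := by ring
  calc ((a + b) / 2) ^ 2 = (((a + b) / 2) ^ r) ^ (2 / r) := by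
        rw [← Real.rpow_mul hm, mul_div_cancel₀ _ hr0.ne', Real.rpow_two]
    _ ≤ ((a ^ r + b ^ r) / 2) ^ (2 / r) :=
        Real.rpow_le_rpow (Real.rpow_nonneg hm r) h1 (by positivity)

/-- `ab + ¼(a − b)² = ((a + b)/2)²`. [cite: Alomari2019, Lemma 2.3 (case `p = q = 2`, `m = 2`)] -/
theorem mul_add_quarter_sq_sub (a b : ℝ) : a * b + 4⁻¹ * (a - b) ^ 2 = ((a + b) / 2) ^ 2 := by ring

end Scalar

/-! ## § 2. The operator steps: positivity, additivity, McCarthy -/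

section Steps

variable (S : Matrix n n ℂ) {x : n → ℂ}

omit [DecidableEq n] in
/-- `⟨(M + N)x, x⟩ = ⟨Mx, x⟩ + ⟨Nx, x⟩` (real parts). [folklore] -/
private theorem re_quadForm_add (M N : Matrix n n ℂ) (x : n → ℂ) :
    RCLike.re (star x ⬝ᵥ ((M + N) *ᵥ x)) = RCLike.re (star x ⬝ᵥ (M *ᵥ x)) + RCLike.re (star x ⬝ᵥ (N *ᵥ x)) := by
  rw [add_mulVec, dotProduct_add, map_add]

omit [DecidableEq n] in
/-- `⟨(M − N)x, x⟩ = ⟨Mx, x⟩ − ⟨Nx, x⟩` (real parts). [folklore] -/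
private theorem re_quadForm_sub (M N : Matrix n n ℂ) (x : n → ℂ) :
    RCLike.re (star x ⬝ᵥ ((M - N) *ᵥ x)) = RCLike.re (star x ⬝ᵥ (M *ᵥ x)) - RCLike.re (star x ⬝ᵥ (N *ᵥ x)) := by
  rw [sub_mulVec, dotProduct_sub, map_sub]

/-- `Re⟨Mx, x⟩ ≤ ‖M‖` for a unit vector `x` («Taking the supremum over all unit vector x»). [cite: Alomari2019,
Theorem 2.12 (proof, last step)] -/
theorem re_quadForm_le_l2_opNorm (M : Matrix n n ℂ) (hx : star x ⬝ᵥ x = 1) :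
    RCLike.re (star x ⬝ᵥ (M *ᵥ x)) ≤ ‖M‖ :=
  (RCLike.re_le_norm _).trans (norm_quadForm_le_norm M hx)

/-- `0 ≤ ⟨S^α x, x⟩` (`S^α ⪰ 0`). [cite: Alomari2019, Lemma 2.1 (setting: `S ≥ 0`)] -/
theorem re_quadForm_rpow_nonneg (α : ℝ) (x : n → ℂ) : 0 ≤ RCLike.re (star x ⬝ᵥ (S ^ α *ᵥ x)) :=
  (posSemidef_rpow S α).re_dotProduct_nonneg x

/-- **(2.1) in the form used: `⟨S^α x, x⟩^s ≤ ⟨S^{αs}x, x⟩`** for `S ⪰ 0`, `α ≥ 0`, `s ≥ 1`, `x` a unit vector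
(Hölder–McCarthy for `S^α`, and `(S^α)^s = S^{αs}`). [cite: Alomari2019, Lemma 2.1 (2.1)] -/
theorem re_quadForm_rpow_rpow_le (hS : S.PosSemidef) (hx : star x ⬝ᵥ x = 1) {α s : ℝ} (hα : 0 ≤ α) (hs : 1 ≤ s) :
    RCLike.re (star x ⬝ᵥ (S ^ α *ᵥ x)) ^ s ≤ RCLike.re (star x ⬝ᵥ (S ^ (α * s) *ᵥ x)) := by
  have h := holderMcCarthy_one_le (posSemidef_rpow S α) hx hs
  rwa [rpow_rpow_of_nonneg hS hα (by linarith)] at h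

/-- `⟨S^α x, x⟩² ≤ ⟨S^{2α}x, x⟩` (the case `s = 2`). [cite: Alomari2019, Lemma 2.1 (2.1), `r = 2`] -/
theorem re_quadForm_rpow_sq_le (hS : S.PosSemidef) (hx : star x ⬝ᵥ x = 1) {α : ℝ} (hα : 0 ≤ α) :
    RCLike.re (star x ⬝ᵥ (S ^ α *ᵥ x)) ^ 2 ≤ RCLike.re (star x ⬝ᵥ (S ^ (2 * α) *ᵥ x)) := by
  have h := re_quadForm_rpow_rpow_le S hS hx hα (s := 2) (by norm_num)
  rwa [Real.rpow_two, mul_comm α 2] at h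

end Steps

/-! ## § 3. Theorem 2.12 (2.13) and its cases (2.14), Remarks 2.13–2.14 -/

section Thm212

variable (T : Matrix n n ℂ) {x : n → ℂ}

/-- **Theorem 2.12, (2.13), pointwise with the quadratic forms:** for `α, β ≥ 0`, `α + β ≥ 1`, `s ≥ 1` and a unit
vector `x`, `|⟨T|T|^{α+β−1}x, x⟩|^{2s} ≤ ½(⟨|T|^{4sα}x, x⟩ + ⟨|T^*|^{4sβ}x, x⟩) − ½(⟨|T|^{2sα}x, x⟩ − ⟨|T^*|^{2sβ}x, x⟩)²`
(Furuta, `t ↦ t^s`, Lemma 2.2 with `p = q = 2`, (2.1)). [cite: Alomari2019, Theorem 2.12 (proof of (2.13), the displayed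
chain for a unit vector `x`)] -/
theorem alomari_2_13_pointwise {α β : ℝ} (hα : 0 ≤ α) (hβ : 0 ≤ β) (hαβ : 1 ≤ α + β) {s : ℝ} (hs : 1 ≤ s)
    (hx : star x ⬝ᵥ x = 1) :
    ‖star x ⬝ᵥ ((T * CFC.sqrt (Tᴴ * T) ^ (α + β - 1)) *ᵥ x)‖ ^ (2 * s)
      ≤ 2⁻¹ * (RCLike.re (star x ⬝ᵥ ((Tᴴ * T) ^ (2 * s * α) *ᵥ x))
          + RCLike.re (star x ⬝ᵥ ((T * Tᴴ) ^ (2 * s * β) *ᵥ x)))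
        - 2⁻¹ * (RCLike.re (star x ⬝ᵥ ((Tᴴ * T) ^ (s * α) *ᵥ x))
          - RCLike.re (star x ⬝ᵥ ((T * Tᴴ) ^ (s * β) *ᵥ x))) ^ 2 := by
  have hP : (Tᴴ * T).PosSemidef := posSemidef_conjTranspose_mul_self T
  have hQ : (T * Tᴴ).PosSemidef := posSemidef_self_mul_conjTranspose T
  have hs0 : 0 ≤ s := by linarith
  -- Furuta with `y = x`
  have hF := furuta_norm_sq_inner_le T hα hβ hαβ x x
  have hq := norm_nonneg (star x ⬝ᵥ ((T * CFC.sqrt (Tᴴ * T) ^ (α + β - 1)) *ᵥ x))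
  generalize ‖star x ⬝ᵥ ((T * CFC.sqrt (Tᴴ * T) ^ (α + β - 1)) *ᵥ x)‖ = q at hF hq ⊢
  have ha := re_quadForm_rpow_nonneg (Tᴴ * T) α x
  have hb := re_quadForm_rpow_nonneg (T * Tᴴ) β x
  -- convexity of `t ↦ t^s` ((2.1) for `S^α`): `a^s ≤ a_s`, `b^s ≤ b_s`
  have has := re_quadForm_rpow_rpow_le (Tᴴ * T) hP hx hα hs
  have hbs := re_quadForm_rpow_rpow_le (T * Tᴴ) hQ hx hβ hs
  rw [mul_comm α s] at has
  rw [mul_comm β s] at hbs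
  -- (2.1) with `r = 2`: `a_s² ≤ A₂`, `b_s² ≤ B₂`
  have hA2 := re_quadForm_rpow_sq_le (Tᴴ * T) hP hx (α := s * α) (by positivity)
  have hB2 := re_quadForm_rpow_sq_le (T * Tᴴ) hQ hx (α := s * β) (by positivity)
  rw [← mul_assoc] at hA2 hB2
  have has0 := re_quadForm_rpow_nonneg (Tᴴ * T) (s * α) x
  have hbs0 := re_quadForm_rpow_nonneg (T * Tᴴ) (s * β) x
  generalize RCLike.re (star x ⬝ᵥ ((Tᴴ * T) ^ α *ᵥ x)) = a at hF ha has
  generalize RCLike.re (star x ⬝ᵥ ((T * Tᴴ) ^ β *ᵥ x)) = b at hF hb hbs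
  generalize RCLike.re (star x ⬝ᵥ ((Tᴴ * T) ^ (s * α) *ᵥ x)) = A at has hA2 has0 ⊢
  generalize RCLike.re (star x ⬝ᵥ ((T * Tᴴ) ^ (s * β) *ᵥ x)) = B at hbs hB2 hbs0 ⊢
  generalize RCLike.re (star x ⬝ᵥ ((Tᴴ * T) ^ (2 * s * α) *ᵥ x)) = A₂ at hA2 ⊢
  generalize RCLike.re (star x ⬝ᵥ ((T * Tᴴ) ^ (2 * s * β) *ᵥ x)) = B₂ at hB2 ⊢
  -- `q^{2s} = (q²)^s ≤ (ab)^s = a^s b^s ≤ A B = ½(A² + B²) − ½(A − B)² ≤ ½(A₂ + B₂) − ½(A − B)²`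
  have h1 : q ^ (2 * s) ≤ (a * b) ^ s := by
    rw [Real.rpow_mul hq, Real.rpow_two]
    exact Real.rpow_le_rpow (sq_nonneg q) hF hs0
  have h2 : (a * b) ^ s ≤ A * B := by
    rw [Real.mul_rpow ha hb]
    exact mul_le_mul has hbs (Real.rpow_nonneg hb s) has0
  have h3 : A * B = 2⁻¹ * (A ^ 2 + B ^ 2) - 2⁻¹ * (A - B) ^ 2 := by ring
  nlinarith

/-- **Theorem 2.12, (2.13): `w^{2s}(T|T|^{α+β−1}) ≤ ½‖|T|^{4sα} + |T^*|^{4sβ}‖ − ½ inf_{‖x‖=1}(⟨|T|^{2sα}x,x⟩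
− ⟨|T^*|^{2sβ}x,x⟩)²`**, pointwise: for every unit `x`, `|⟨T|T|^{α+β−1}x, x⟩|^{2s} ≤ ½‖(T^*T)^{2sα} + (TT^*)^{2sβ}‖
− ½(⟨(T^*T)^{sα}x,x⟩ − ⟨(TT^*)^{sβ}x,x⟩)²` (`α, β ≥ 0`, `α + β ≥ 1`, `s ≥ 1`). [cite: Alomari2019, Theorem 2.12 (2.13)] -/
theorem alomari_2_13 {α β : ℝ} (hα : 0 ≤ α) (hβ : 0 ≤ β) (hαβ : 1 ≤ α + β) {s : ℝ} (hs : 1 ≤ s)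
    (hx : star x ⬝ᵥ x = 1) :
    ‖star x ⬝ᵥ ((T * CFC.sqrt (Tᴴ * T) ^ (α + β - 1)) *ᵥ x)‖ ^ (2 * s)
      ≤ 2⁻¹ * ‖(Tᴴ * T) ^ (2 * s * α) + (T * Tᴴ) ^ (2 * s * β)‖
        - 2⁻¹ * (RCLike.re (star x ⬝ᵥ ((Tᴴ * T) ^ (s * α) *ᵥ x))
          - RCLike.re (star x ⬝ᵥ ((T * Tᴴ) ^ (s * β) *ᵥ x))) ^ 2 := by
  have h := alomari_2_13_pointwise T hα hβ hαβ hs hx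
  have hN := re_quadForm_le_l2_opNorm ((Tᴴ * T) ^ (2 * s * α) + (T * Tᴴ) ^ (2 * s * β)) hx
  rw [re_quadForm_add] at hN
  linarith

/-- `T|T|⁰ = T`: the case `α + β = 1` of `T|T|^{α+β−1}`. [cite: Alomari2019, Remark 2.13 (setting `α = β = ½`)] -/
theorem mul_sqrt_rpow_zero : T * CFC.sqrt (Tᴴ * T) ^ (0 : ℝ) = T := by
  rw [CFC.rpow_zero _ (CFC.sqrt_nonneg _), Matrix.mul_one]

/-- **Remark 2.13: `w^{2s}(T) ≤ ½‖|T|^{2s} + |T^*|^{2s}‖ − ½ inf_{‖x‖=1}(⟨|T|^s x,x⟩ − ⟨|T^*|^s x,x⟩)²`** (`s ≥ 1`),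
pointwise: `|⟨Tx, x⟩|^{2s} ≤ ½‖(T^*T)^s + (TT^*)^s‖ − ½(⟨(T^*T)^{s/2}x,x⟩ − ⟨(TT^*)^{s/2}x,x⟩)²` for every unit `x`
(`α = β = ½` in (2.13)). [cite: Alomari2019, Remark 2.13] -/
theorem alomari_rem_2_13 {s : ℝ} (hs : 1 ≤ s) (hx : star x ⬝ᵥ x = 1) :
    ‖star x ⬝ᵥ (T *ᵥ x)‖ ^ (2 * s)
      ≤ 2⁻¹ * ‖(Tᴴ * T) ^ s + (T * Tᴴ) ^ s‖
        - 2⁻¹ * (RCLike.re (star x ⬝ᵥ ((Tᴴ * T) ^ (s / 2) *ᵥ x))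
          - RCLike.re (star x ⬝ᵥ ((T * Tᴴ) ^ (s / 2) *ᵥ x))) ^ 2 := by
  have h := alomari_2_13 T (α := 1 / 2) (β := 1 / 2) (by norm_num) (by norm_num) (by norm_num) hs hx
  rwa [show (1 / 2 + 1 / 2 - 1 : ℝ) = 0 by norm_num, mul_sqrt_rpow_zero, show 2 * s * (1 / 2) = s by ring,
    show s * (1 / 2 : ℝ) = s / 2 by ring] at h

/-- **(2.14): `w²(T) ≤ ½‖T^*T + TT^*‖ − ½ inf_{‖x‖=1}(⟨|T|x, x⟩ − ⟨|T^*|x, x⟩)²`, a refinement of the upper bound in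
Kittaneh's inequality**, pointwise: `|⟨Tx, x⟩|² ≤ ½‖T^*T + TT^*‖ − ½(⟨|T|x, x⟩ − ⟨|T^*|x, x⟩)²` for every unit `x`.
[cite: Alomari2019, Remark 2.13 (2.14)] -/
theorem alomari_2_14 (hx : star x ⬝ᵥ x = 1) :
    ‖star x ⬝ᵥ (T *ᵥ x)‖ ^ 2
      ≤ 2⁻¹ * ‖Tᴴ * T + T * Tᴴ‖
        - 2⁻¹ * (RCLike.re (star x ⬝ᵥ (CFC.sqrt (Tᴴ * T) *ᵥ x))
          - RCLike.re (star x ⬝ᵥ (CFC.sqrt (T * Tᴴ) *ᵥ x))) ^ 2 := by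
  have h := alomari_rem_2_13 T (s := 1) le_rfl hx
  rwa [mul_one, Real.rpow_two, rpow_one (posSemidef_conjTranspose_mul_self T),
    rpow_one (posSemidef_self_mul_conjTranspose T), ← sqrt_eq_rpow, ← sqrt_eq_rpow] at h

/-- **Remark 2.14 (`α = β = 1`, `s = 1`, `p = q = 2`): `w²(T|T|) ≤ ½‖|T|⁴ + |T^*|⁴‖ − ½ inf_{‖x‖=1}(⟨|T|²x,x⟩
− ⟨|T^*|²x,x⟩)²`**, pointwise: `|⟨T|T|x, x⟩|² ≤ ½‖(T^*T)² + (TT^*)²‖ − ½(⟨T^*Tx,x⟩ − ⟨TT^*x,x⟩)²` for every unit `x`.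
[cite: Alomari2019, Remark 2.14] -/
theorem alomari_rem_2_14 (hx : star x ⬝ᵥ x = 1) :
    ‖star x ⬝ᵥ ((T * CFC.sqrt (Tᴴ * T)) *ᵥ x)‖ ^ 2
      ≤ 2⁻¹ * ‖(Tᴴ * T) ^ 2 + (T * Tᴴ) ^ 2‖
        - 2⁻¹ * (RCLike.re (star x ⬝ᵥ ((Tᴴ * T) *ᵥ x)) - RCLike.re (star x ⬝ᵥ ((T * Tᴴ) *ᵥ x))) ^ 2 := by
  have hP : (Tᴴ * T).PosSemidef := posSemidef_conjTranspose_mul_self T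
  have hQ : (T * Tᴴ).PosSemidef := posSemidef_self_mul_conjTranspose T
  have h := alomari_2_13 T (α := 1) (β := 1) zero_le_one zero_le_one (by norm_num) (s := 1) le_rfl hx
  rwa [show (1 + 1 - 1 : ℝ) = 1 by norm_num, CFC.rpow_one _ (CFC.sqrt_nonneg _), mul_one, mul_one, mul_one,
    Real.rpow_two, rpow_one hP, rpow_one hQ, rpow_two hP, rpow_two hQ, ← sq, ← sq] at h

end Thm212

/-! ## § 4. Corollary 2.5 and Remark 2.6 -/

section Cor25

variable (T : Matrix n n ℂ) {x : n → ℂ}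

/-- **Corollary 2.5, pointwise with the quadratic forms:** for `α, β ≥ 0`, `α + β ≥ 1`, `r ≥ 1` and a unit `x`,
`|⟨T|T|^{α+β−1}x, x⟩|² ≤ (½(⟨|T|^{2rα}x,x⟩ + ⟨|T^*|^{2rβ}x,x⟩))^{2/r} − ¼(⟨|T|^{2α}x,x⟩ − ⟨|T^*|^{2β}x,x⟩)²` (Furuta,
Lemma 2.3 with `p = q = 2`, `m = 2`, and (2.1)). [cite: Alomari2019, Corollary 2.5 (via Theorem 2.4, proof chain for a
unit vector `x`, `m = 2`)] -/
theorem alomari_cor_2_5_pointwise {α β : ℝ} (hα : 0 ≤ α) (hβ : 0 ≤ β) (hαβ : 1 ≤ α + β) {r : ℝ} (hr : 1 ≤ r)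
    (hx : star x ⬝ᵥ x = 1) :
    ‖star x ⬝ᵥ ((T * CFC.sqrt (Tᴴ * T) ^ (α + β - 1)) *ᵥ x)‖ ^ 2
      ≤ (2⁻¹ * (RCLike.re (star x ⬝ᵥ ((Tᴴ * T) ^ (r * α) *ᵥ x))
          + RCLike.re (star x ⬝ᵥ ((T * Tᴴ) ^ (r * β) *ᵥ x)))) ^ (2 / r)
        - 4⁻¹ * (RCLike.re (star x ⬝ᵥ ((Tᴴ * T) ^ α *ᵥ x)) - RCLike.re (star x ⬝ᵥ ((T * Tᴴ) ^ β *ᵥ x))) ^ 2 := by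
  have hP : (Tᴴ * T).PosSemidef := posSemidef_conjTranspose_mul_self T
  have hQ : (T * Tᴴ).PosSemidef := posSemidef_self_mul_conjTranspose T
  have hr0 : 0 < r := by linarith
  have hF := furuta_norm_sq_inner_le T hα hβ hαβ x x
  have ha := re_quadForm_rpow_nonneg (Tᴴ * T) α x
  have hb := re_quadForm_rpow_nonneg (T * Tᴴ) β x
  -- (2.1): `a^r ≤ a_r`, `b^r ≤ b_r`
  have har := re_quadForm_rpow_rpow_le (Tᴴ * T) hP hx hα hr
  have hbr := re_quadForm_rpow_rpow_le (T * Tᴴ) hQ hx hβ hr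
  rw [mul_comm α r] at har
  rw [mul_comm β r] at hbr
  generalize ‖star x ⬝ᵥ ((T * CFC.sqrt (Tᴴ * T) ^ (α + β - 1)) *ᵥ x)‖ = q at hF ⊢
  generalize RCLike.re (star x ⬝ᵥ ((Tᴴ * T) ^ α *ᵥ x)) = a at hF ha har ⊢
  generalize RCLike.re (star x ⬝ᵥ ((T * Tᴴ) ^ β *ᵥ x)) = b at hF hb hbr ⊢
  generalize RCLike.re (star x ⬝ᵥ ((Tᴴ * T) ^ (r * α) *ᵥ x)) = A at har ⊢
  generalize RCLike.re (star x ⬝ᵥ ((T * Tᴴ) ^ (r * β) *ᵥ x)) = B at hbr ⊢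
  -- `q² ≤ ab = ((a+b)/2)² − ¼(a−b)² ≤ ((a^r+b^r)/2)^{2/r} − ¼(a−b)² ≤ ((A+B)/2)^{2/r} − ¼(a−b)²`
  have h1 := sq_arith_mean_le_powerMean ha hb hr
  have h2 : ((a ^ r + b ^ r) / 2) ^ (2 / r) ≤ (2⁻¹ * (A + B)) ^ (2 / r) :=
    Real.rpow_le_rpow (by positivity) (by linarith) (by positivity)
  nlinarith [mul_add_quarter_sq_sub a b]

/-- **Corollary 2.5: `w²(T|T|^{α+β−1}) ≤ 2^{−2/r}‖|T|^{2rα} + |T^*|^{2rβ}‖^{2/r} − ¼ inf_{‖x‖=1}(⟨|T|^{2α}x,x⟩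
− ⟨|T^*|^{2β}x,x⟩)²`**, pointwise: for every unit `x`, `|⟨T|T|^{α+β−1}x, x⟩|² ≤ (1/2^{2/r})‖(T^*T)^{rα} + (TT^*)^{rβ}‖^{2/r}
− ¼(⟨(T^*T)^α x,x⟩ − ⟨(TT^*)^β x,x⟩)²` (`α, β ≥ 0`, `α + β ≥ 1`, `r ≥ 1`). [cite: Alomari2019, Corollary 2.5 (2.6)] -/
theorem alomari_cor_2_5 {α β : ℝ} (hα : 0 ≤ α) (hβ : 0 ≤ β) (hαβ : 1 ≤ α + β) {r : ℝ} (hr : 1 ≤ r)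
    (hx : star x ⬝ᵥ x = 1) :
    ‖star x ⬝ᵥ ((T * CFC.sqrt (Tᴴ * T) ^ (α + β - 1)) *ᵥ x)‖ ^ 2
      ≤ 1 / 2 ^ (2 / r) * ‖(Tᴴ * T) ^ (r * α) + (T * Tᴴ) ^ (r * β)‖ ^ (2 / r)
        - 4⁻¹ * (RCLike.re (star x ⬝ᵥ ((Tᴴ * T) ^ α *ᵥ x)) - RCLike.re (star x ⬝ᵥ ((T * Tᴴ) ^ β *ᵥ x))) ^ 2 := by
  have hr0 : 0 < r := by linarith
  have h := alomari_cor_2_5_pointwise T hα hβ hαβ hr hx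
  have hN := re_quadForm_le_l2_opNorm ((Tᴴ * T) ^ (r * α) + (T * Tᴴ) ^ (r * β)) hx
  rw [re_quadForm_add] at hN
  have h0 : 0 ≤ RCLike.re (star x ⬝ᵥ ((Tᴴ * T) ^ (r * α) *ᵥ x)) + RCLike.re (star x ⬝ᵥ ((T * Tᴴ) ^ (r * β) *ᵥ x)) :=
    add_nonneg (re_quadForm_rpow_nonneg _ _ x) (re_quadForm_rpow_nonneg _ _ x)
  have h2 : (2⁻¹ * (RCLike.re (star x ⬝ᵥ ((Tᴴ * T) ^ (r * α) *ᵥ x))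
      + RCLike.re (star x ⬝ᵥ ((T * Tᴴ) ^ (r * β) *ᵥ x)))) ^ (2 / r)
        ≤ (2⁻¹ * ‖(Tᴴ * T) ^ (r * α) + (T * Tᴴ) ^ (r * β)‖) ^ (2 / r) :=
    Real.rpow_le_rpow (by positivity) (by linarith) (by positivity)
  rw [Real.mul_rpow (by norm_num) (norm_nonneg _), Real.inv_rpow (by norm_num : (0 : ℝ) ≤ 2)] at h2
  rw [one_div]
  linarith

/-- **Remark 2.6 (`r = 1`): `w²(T|T|^{α+β−1}) ≤ ¼‖|T|^{2α} + |T^*|^{2β}‖² − ¼ inf_{‖x‖=1}(⟨|T|^{2α}x,x⟩ − ⟨|T^*|^{2β}x,x⟩)²`**,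
pointwise for every unit `x`. [cite: Alomari2019, Remark 2.6 (setting `r = 1`)] -/
theorem alomari_rem_2_6 {α β : ℝ} (hα : 0 ≤ α) (hβ : 0 ≤ β) (hαβ : 1 ≤ α + β) (hx : star x ⬝ᵥ x = 1) :
    ‖star x ⬝ᵥ ((T * CFC.sqrt (Tᴴ * T) ^ (α + β - 1)) *ᵥ x)‖ ^ 2
      ≤ 4⁻¹ * ‖(Tᴴ * T) ^ α + (T * Tᴴ) ^ β‖ ^ 2
        - 4⁻¹ * (RCLike.re (star x ⬝ᵥ ((Tᴴ * T) ^ α *ᵥ x)) - RCLike.re (star x ⬝ᵥ ((T * Tᴴ) ^ β *ᵥ x))) ^ 2 := by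
  have h := alomari_cor_2_5 T hα hβ hαβ (r := 1) le_rfl hx
  rw [one_mul, one_mul, div_one, Real.rpow_two, Real.rpow_two, show (1 : ℝ) / 2 ^ 2 = 4⁻¹ by norm_num] at h
  exact h

/-- **Remark 2.6, `α = β = ½`: `w²(T) ≤ ¼‖|T| + |T^*|‖² − ¼ inf_{‖x‖=1}(⟨|T|x, x⟩ − ⟨|T^*|x, x⟩)²`**, pointwise:
`|⟨Tx, x⟩|² ≤ ¼‖|T| + |T^*|‖² − ¼(⟨|T|x, x⟩ − ⟨|T^*|x, x⟩)²` for every unit `x`. [cite: Alomari2019, Remark 2.6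
(choosing `α = β = ½`)] -/
theorem alomari_rem_2_6_half (hx : star x ⬝ᵥ x = 1) :
    ‖star x ⬝ᵥ (T *ᵥ x)‖ ^ 2
      ≤ 4⁻¹ * ‖CFC.sqrt (Tᴴ * T) + CFC.sqrt (T * Tᴴ)‖ ^ 2
        - 4⁻¹ * (RCLike.re (star x ⬝ᵥ (CFC.sqrt (Tᴴ * T) *ᵥ x))
          - RCLike.re (star x ⬝ᵥ (CFC.sqrt (T * Tᴴ) *ᵥ x))) ^ 2 := by
  have h := alomari_rem_2_6 T (α := 1 / 2) (β := 1 / 2) (by norm_num) (by norm_num) (by norm_num) hx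
  rwa [show (1 / 2 + 1 / 2 - 1 : ℝ) = 0 by norm_num, mul_sqrt_rpow_zero, ← sqrt_eq_rpow, ← sqrt_eq_rpow] at h

/-- **Remark 2.6, `α = β = 1`: `w²(T|T|) ≤ ¼‖T^*T + TT^*‖² − ¼ inf_{‖x‖=1}⟨[T^*T − TT^*]x, x⟩²`**, pointwise:
`|⟨T|T|x, x⟩|² ≤ ¼‖T^*T + TT^*‖² − ¼⟨(T^*T − TT^*)x, x⟩²` for every unit `x`. [cite: Alomari2019, Remark 2.6 (choosing
`α = β = 1`)] -/
theorem alomari_rem_2_6_one (hx : star x ⬝ᵥ x = 1) :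
    ‖star x ⬝ᵥ ((T * CFC.sqrt (Tᴴ * T)) *ᵥ x)‖ ^ 2
      ≤ 4⁻¹ * ‖Tᴴ * T + T * Tᴴ‖ ^ 2 - 4⁻¹ * RCLike.re (star x ⬝ᵥ ((Tᴴ * T - T * Tᴴ) *ᵥ x)) ^ 2 := by
  have hP : (Tᴴ * T).PosSemidef := posSemidef_conjTranspose_mul_self T
  have hQ : (T * Tᴴ).PosSemidef := posSemidef_self_mul_conjTranspose T
  have h := alomari_rem_2_6 T (α := 1) (β := 1) zero_le_one zero_le_one (by norm_num) hx
  rwa [show (1 + 1 - 1 : ℝ) = 1 by norm_num, CFC.rpow_one _ (CFC.sqrt_nonneg _), rpow_one hP, rpow_one hQ,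
    ← re_quadForm_sub] at h

end Cor25

/-! ## § 5. Lemma 2.2 (Kittaneh–Manasrah) and the general Theorem 2.12 -/

section Thm212General

/-- The core of the Kittaneh–Manasrah refinement: for `u, v ≥ 0` and `0 < w ≤ 1`,
`u^w v^{2−w} + (w/2)(u − v)² ≤ (w/2)u² + (1 − w/2)v²` (weighted AM–GM for `uv` and `v²` with weights `w`, `1 − w`).
[cite: Alomari2019, Lemma 2.2 (proof core, after Kittaneh–Manasrah)] -/
theorem rpow_mul_rpow_add_sq_le {u v w : ℝ} (hu : 0 ≤ u) (hv : 0 ≤ v) (hw0 : 0 < w) (hw1 : w ≤ 1) :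
    u ^ w * v ^ (2 - w) + w / 2 * (u - v) ^ 2 ≤ w / 2 * u ^ 2 + (1 - w / 2) * v ^ 2 := by
  have hamgm := Real.geom_mean_le_arith_mean2_weighted hw0.le (by linarith : 0 ≤ 1 - w) (mul_nonneg hu hv)
    (sq_nonneg v) (by ring)
  have e : (u * v) ^ w * (v ^ 2) ^ (1 - w) = u ^ w * v ^ (2 - w) := by
    rw [Real.mul_rpow hu hv, ← Real.rpow_two v, ← Real.rpow_mul hv, mul_assoc,
      ← Real.rpow_add' hv (ne_of_gt (by linarith : 0 < w + 2 * (1 - w))),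
      show w + 2 * (1 - w) = 2 - w by ring]
  rw [e] at hamgm
  have key : w / 2 * u ^ 2 + (1 - w / 2) * v ^ 2 = w * (u * v) + (1 - w) * v ^ 2 + w / 2 * (u - v) ^ 2 := by ring
  linarith

/-- **Lemma 2.2 (Kittaneh–Manasrah's refined Young inequality): `ab + min{1/p, 1/q}(a^{p/2} − b^{q/2})² ≤ a^p/p + b^q/q`**
for `a, b ≥ 0`, `p, q > 1`, `1/p + 1/q = 1`. [cite: Alomari2019, Lemma 2.2] -/
theorem kittanehManasrah_young {a b : ℝ} (ha : 0 ≤ a) (hb : 0 ≤ b) {p q : ℝ} (hp : 1 < p) (hq : 1 < q)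
    (hpq : p⁻¹ + q⁻¹ = 1) :
    a * b + min p⁻¹ q⁻¹ * (a ^ (p / 2) - b ^ (q / 2)) ^ 2 ≤ a ^ p / p + b ^ q / q := by
  have hp0 : 0 < p := by linarith
  have hq0 : 0 < q := by linarith
  -- `u = a^{p/2}`, `v = b^{q/2}`: `u² = a^p`, `v² = b^q`, `u^{2/p} = a`, `v^{2/q} = b`
  have hu : 0 ≤ a ^ (p / 2) := Real.rpow_nonneg ha _
  have hv : 0 ≤ b ^ (q / 2) := Real.rpow_nonneg hb _
  have hu2 : (a ^ (p / 2)) ^ 2 = a ^ p := by rw [← Real.rpow_two, ← Real.rpow_mul ha, div_mul_cancel₀ _ two_ne_zero]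
  have hv2 : (b ^ (q / 2)) ^ 2 = b ^ q := by rw [← Real.rpow_two, ← Real.rpow_mul hb, div_mul_cancel₀ _ two_ne_zero]
  rcases le_total p⁻¹ q⁻¹ with hle | hle
  · -- `r₀ = 1/p`, `w = 2/p ≤ 1`
    rw [min_eq_left hle]
    have hw1 : 2 * p⁻¹ ≤ 1 := by linarith
    have h := rpow_mul_rpow_add_sq_le hu hv (by positivity : 0 < 2 * p⁻¹) hw1
    have e1 : (a ^ (p / 2)) ^ (2 * p⁻¹) = a := by
      rw [← Real.rpow_mul ha, show p / 2 * (2 * p⁻¹) = 1 by field_simp, Real.rpow_one]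
    have e2 : (b ^ (q / 2)) ^ (2 - 2 * p⁻¹) = b := by
      rw [← Real.rpow_mul hb, show (2 : ℝ) - 2 * p⁻¹ = 2 * q⁻¹ by linarith, show q / 2 * (2 * q⁻¹) = 1 by field_simp,
        Real.rpow_one]
    rw [e1, e2, hu2, hv2, show 2 * p⁻¹ / 2 = p⁻¹ by ring, show 1 - p⁻¹ = q⁻¹ by linarith] at h
    rw [show a ^ p / p = p⁻¹ * a ^ p from div_eq_inv_mul _ _, show b ^ q / q = q⁻¹ * b ^ q from div_eq_inv_mul _ _]
    linarith
  · -- `r₀ = 1/q`, `w = 2/q ≤ 1`, roles of `(a, p)` and `(b, q)` exchanged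
    rw [min_eq_right hle]
    have hw1 : 2 * q⁻¹ ≤ 1 := by linarith
    have h := rpow_mul_rpow_add_sq_le hv hu (by positivity : 0 < 2 * q⁻¹) hw1
    have e1 : (b ^ (q / 2)) ^ (2 * q⁻¹) = b := by
      rw [← Real.rpow_mul hb, show q / 2 * (2 * q⁻¹) = 1 by field_simp, Real.rpow_one]
    have e2 : (a ^ (p / 2)) ^ (2 - 2 * q⁻¹) = a := by
      rw [← Real.rpow_mul ha, show (2 : ℝ) - 2 * q⁻¹ = 2 * p⁻¹ by linarith, show p / 2 * (2 * p⁻¹) = 1 by field_simp,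
        Real.rpow_one]
    rw [e1, e2, hu2, hv2, show 2 * q⁻¹ / 2 = q⁻¹ by ring, show 1 - q⁻¹ = p⁻¹ by linarith] at h
    rw [show a ^ p / p = p⁻¹ * a ^ p from div_eq_inv_mul _ _, show b ^ q / q = q⁻¹ * b ^ q from div_eq_inv_mul _ _]
    have e3 : (b ^ (q / 2) - a ^ (p / 2)) ^ 2 = (a ^ (p / 2) - b ^ (q / 2)) ^ 2 := by ring
    rw [e3] at h
    linarith

variable (T : Matrix n n ℂ) {x : n → ℂ}

omit [DecidableEq n] in
/-- `⟨(cM)x, x⟩ = c⟨Mx, x⟩` for a real scalar `c` (real parts). [folklore] -/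
private theorem re_quadForm_real_smul (c : ℝ) (M : Matrix n n ℂ) (x : n → ℂ) :
    RCLike.re (star x ⬝ᵥ (((c : ℂ) • M) *ᵥ x)) = c * RCLike.re (star x ⬝ᵥ (M *ᵥ x)) := by
  rw [smul_mulVec, dotProduct_smul, smul_eq_mul, RCLike.re_to_complex, RCLike.re_to_complex,
    Complex.re_ofReal_mul]

/-- **Theorem 2.12, pointwise with the quadratic forms:** for `α, β ≥ 0`, `α + β ≥ 1`, `s ≥ 1`, `p, q > 1` with
`1/p + 1/q = 1` and a unit `x`, `|⟨T|T|^{α+β−1}x, x⟩|^{2s} ≤ (1/p)⟨|T|^{2spα}x, x⟩ + (1/q)⟨|T^*|^{2sqβ}x, x⟩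
− r₀(⟨|T|^{2sα}x, x⟩^{p/2} − ⟨|T^*|^{2sβ}x, x⟩^{q/2})²`, `r₀ = min{1/p, 1/q}` (Furuta, `t ↦ t^s`, Lemma 2.2, (2.1)).
[cite: Alomari2019, Theorem 2.12 (proof, the displayed chain for a unit vector `x`)] -/
theorem alomari_thm_2_12_pointwise {α β : ℝ} (hα : 0 ≤ α) (hβ : 0 ≤ β) (hαβ : 1 ≤ α + β) {s : ℝ} (hs : 1 ≤ s)
    {p q : ℝ} (hp : 1 < p) (hq : 1 < q) (hpq : p⁻¹ + q⁻¹ = 1) (hx : star x ⬝ᵥ x = 1) :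
    ‖star x ⬝ᵥ ((T * CFC.sqrt (Tᴴ * T) ^ (α + β - 1)) *ᵥ x)‖ ^ (2 * s)
      ≤ p⁻¹ * RCLike.re (star x ⬝ᵥ ((Tᴴ * T) ^ (s * p * α) *ᵥ x))
          + q⁻¹ * RCLike.re (star x ⬝ᵥ ((T * Tᴴ) ^ (s * q * β) *ᵥ x))
        - min p⁻¹ q⁻¹ * (RCLike.re (star x ⬝ᵥ ((Tᴴ * T) ^ (s * α) *ᵥ x)) ^ (p / 2)
          - RCLike.re (star x ⬝ᵥ ((T * Tᴴ) ^ (s * β) *ᵥ x)) ^ (q / 2)) ^ 2 := by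
  have hP : (Tᴴ * T).PosSemidef := posSemidef_conjTranspose_mul_self T
  have hQ : (T * Tᴴ).PosSemidef := posSemidef_self_mul_conjTranspose T
  have hs0 : 0 ≤ s := by linarith
  have hp0 : 0 < p := by linarith
  have hq0 : 0 < q := by linarith
  have hF := furuta_norm_sq_inner_le T hα hβ hαβ x x
  have hq' := norm_nonneg (star x ⬝ᵥ ((T * CFC.sqrt (Tᴴ * T) ^ (α + β - 1)) *ᵥ x))
  generalize ‖star x ⬝ᵥ ((T * CFC.sqrt (Tᴴ * T) ^ (α + β - 1)) *ᵥ x)‖ = q₀ at hF hq' ⊢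
  have ha := re_quadForm_rpow_nonneg (Tᴴ * T) α x
  have hb := re_quadForm_rpow_nonneg (T * Tᴴ) β x
  have has := re_quadForm_rpow_rpow_le (Tᴴ * T) hP hx hα hs
  have hbs := re_quadForm_rpow_rpow_le (T * Tᴴ) hQ hx hβ hs
  rw [mul_comm α s] at has
  rw [mul_comm β s] at hbs
  -- (2.1) with `r = p`, `r = q`: `A^p ≤ A_p`, `B^q ≤ B_q`
  have hAp := re_quadForm_rpow_rpow_le (Tᴴ * T) hP hx (α := s * α) (s := p) (by positivity) hp.le
  have hBq := re_quadForm_rpow_rpow_le (T * Tᴴ) hQ hx (α := s * β) (s := q) (by positivity) hq.le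
  rw [show s * α * p = s * p * α by ring] at hAp
  rw [show s * β * q = s * q * β by ring] at hBq
  have has0 := re_quadForm_rpow_nonneg (Tᴴ * T) (s * α) x
  have hbs0 := re_quadForm_rpow_nonneg (T * Tᴴ) (s * β) x
  generalize RCLike.re (star x ⬝ᵥ ((Tᴴ * T) ^ α *ᵥ x)) = a at hF ha has
  generalize RCLike.re (star x ⬝ᵥ ((T * Tᴴ) ^ β *ᵥ x)) = b at hF hb hbs
  generalize RCLike.re (star x ⬝ᵥ ((Tᴴ * T) ^ (s * α) *ᵥ x)) = A at has hAp has0 ⊢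
  generalize RCLike.re (star x ⬝ᵥ ((T * Tᴴ) ^ (s * β) *ᵥ x)) = B at hbs hBq hbs0 ⊢
  generalize RCLike.re (star x ⬝ᵥ ((Tᴴ * T) ^ (s * p * α) *ᵥ x)) = Ap at hAp ⊢
  generalize RCLike.re (star x ⬝ᵥ ((T * Tᴴ) ^ (s * q * β) *ᵥ x)) = Bq at hBq ⊢
  have h1 : q₀ ^ (2 * s) ≤ (a * b) ^ s := by
    rw [Real.rpow_mul hq', Real.rpow_two]
    exact Real.rpow_le_rpow (sq_nonneg q₀) hF hs0
  have h2 : (a * b) ^ s ≤ A * B := by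
    rw [Real.mul_rpow ha hb]
    exact mul_le_mul has hbs (Real.rpow_nonneg hb s) has0
  have h3 := kittanehManasrah_young has0 hbs0 hp hq hpq
  have h4 : A ^ p / p ≤ p⁻¹ * Ap := by rw [div_eq_inv_mul]; exact mul_le_mul_of_nonneg_left hAp (by positivity)
  have h5 : B ^ q / q ≤ q⁻¹ * Bq := by rw [div_eq_inv_mul]; exact mul_le_mul_of_nonneg_left hBq (by positivity)
  linarith

/-- **Theorem 2.12: `w^{2s}(T|T|^{α+β−1}) ≤ ‖(1/p)|T|^{2spα} + (1/q)|T^*|^{2sqβ}‖ − r₀ inf_{‖x‖=1}(⟨|T|^{2sα}x,x⟩^{p/2}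
− ⟨|T^*|^{2sβ}x,x⟩^{q/2})²`** (`s ≥ 1`, `p, q > 1`, `1/p + 1/q = 1`, `r₀ = min{1/p, 1/q}`), pointwise: for every unit `x`,
`|⟨T|T|^{α+β−1}x, x⟩|^{2s} ≤ ‖(1/p)(T^*T)^{spα} + (1/q)(TT^*)^{sqβ}‖ − r₀(⟨(T^*T)^{sα}x,x⟩^{p/2} − ⟨(TT^*)^{sβ}x,x⟩^{q/2})²`.
[cite: Alomari2019, Theorem 2.12 (2.12)] -/
theorem alomari_thm_2_12 {α β : ℝ} (hα : 0 ≤ α) (hβ : 0 ≤ β) (hαβ : 1 ≤ α + β) {s : ℝ} (hs : 1 ≤ s)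
    {p q : ℝ} (hp : 1 < p) (hq : 1 < q) (hpq : p⁻¹ + q⁻¹ = 1) (hx : star x ⬝ᵥ x = 1) :
    ‖star x ⬝ᵥ ((T * CFC.sqrt (Tᴴ * T) ^ (α + β - 1)) *ᵥ x)‖ ^ (2 * s)
      ≤ ‖((p⁻¹ : ℝ) : ℂ) • (Tᴴ * T) ^ (s * p * α) + ((q⁻¹ : ℝ) : ℂ) • (T * Tᴴ) ^ (s * q * β)‖
        - min p⁻¹ q⁻¹ * (RCLike.re (star x ⬝ᵥ ((Tᴴ * T) ^ (s * α) *ᵥ x)) ^ (p / 2)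
          - RCLike.re (star x ⬝ᵥ ((T * Tᴴ) ^ (s * β) *ᵥ x)) ^ (q / 2)) ^ 2 := by
  have h := alomari_thm_2_12_pointwise T hα hβ hαβ hs hp hq hpq hx
  have hN := re_quadForm_le_l2_opNorm
    (((p⁻¹ : ℝ) : ℂ) • (Tᴴ * T) ^ (s * p * α) + ((q⁻¹ : ℝ) : ℂ) • (T * Tᴴ) ^ (s * q * β)) hx
  rw [re_quadForm_add, re_quadForm_real_smul, re_quadForm_real_smul] at hN
  linarith

end Thm212General

end Literature.LinearAlgebra.Matrix.NumericalRadiusKatoRefinements
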